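import Summits.CriticalPhenomena.PercolationContinuityZ3.Theorems.PercNearOneGluingNoHeavyLowerTailGuardedTopPacking
import Summits.CriticalPhenomena.PercolationContinuityZ3.Theorems.PercNearOneGluingNoHeavyLowerTailCILReduction
import HarnessLib

/-!
# `NoHeavyLowerTail` (stmt-CriticalPhenomena-4575) — the UNGUARDED top packing `TP_j` closes the crux

Support file (lemma factory `prim-lf-8`, gen 2; `--supports stmt-CriticalPhenomena-4575`).  No definitions, no named
facts, no sorries.  Notation of `…GuardedTopPacking` WITHOUT the guard: `μ = prodBernoulli w` on `Fin n`, relays `A`,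
observer `o ∉ A`, level `j`, `π(v) = C(v) ∩ A`, `N = |π(o)|`, `R_x = {|π(x)| ≤ j}` ("`x` is light"),
`S(x) = μ(R_x)`, `L = {1 ≤ N ≤ j}`.

Rank the relays LIGHTEST FIRST: a ranking `rk : Fin n → ℕ`, injective on `A`, along which `S` is non-increasing
(`rk x < rk y → S(y) ≤ S(x)`).  On `L` the block of `o` is nonempty; its `rk`-first relay is `top(π(o))`, and
`W_x := L ∩ {o ↔ x} ∩ {∀ y ∈ A, rk y < rk x → o ↮ y}` is the event "`top(π(o)) = x`" (so `W_x ⊆ R_x`).  The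
UNGUARDED TOP PACKING inequality of the seat's candidate list (CANDIDATES.md A3) is

  `TP_j :   Σ_{x ∈ A} μ(W_x) / S(x) ≤ 1`

("`Σ_x P(top(π(o)) = x, π(o) small | x light) ≤ 1`"; order-free form `Σ_B P(π(o) = B, 1 ≤ |B| ≤ j)/max_{x∈B} S(x) ≤ 1`).
Level `j = 1` is Kozma–Nitzan's Lemma 2 with singleton blocks (`Theorems.lonelyRelay`); it is the guard-free twin of
the lead's `GTP_j` (`Theorems.noHeavyLowerTail_of_guardedTopPacking`); hub calibration = kcluster's (WF), i.e. additive
(not KN-Conjecture-1-hard), whereas its strengthening `Σ_x μ(W_x)/S(x) ≤ μ(o ↔ A)` (= prim-gen-swap's PBCR(A)) is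
Conjecture-1-hard (run/shared/lean/prim/prim-lf-8/CALIBRATION-LF8.md).  Status: OPEN; 0 violations in ttrl2's exhaustive
exact census `n ≤ 7` (885 880 instances, gtp/README §TP), the seat's exhaustive census (2 463 768 (instance, level) cases)
and scale-free adversarial climbs; equality iff `o` is glued to a relay that is `S`-best among the relays it can share
a small block with.

This file PROVES  TP (all levels, all `S`-antitone rankings) ⇒ CIL (`stub_cumulativeIsolation` shape) ⇒ `NoHeavyLowerTail`:
* `TopPacking.L_subset_biUnion`, `pairwiseDisjoint_W`, `real_L_eq_sum` — `μ(L) = Σ_{x∈A} μ(W_x)` (partition by the top relay);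
* `TopPacking.W_subset_R` — `W_x ⊆ R_x`;
* `cumulativeIsolation_of_topPacking` — TP ⇒ `μ(L) ≤ max_x S(x)`;
* `noHeavyLowerTail_of_topPacking` — TP ⇒ `NoHeavyLowerTail`.
(TP ⇒ the two-level packing QP ⇒ the quantitative gap QG of `…QuantGapReductions` is the finer chain; the crux needs only this file.)
-/

noncomputable section

namespace Summit.CriticalPhenomena.PercolationContinuityZ3.Theorems

open MeasureTheory Set Literature.Probability.LatticeModels Literature.Probability.Percolation
open scoped Classical BigOperators

variable {n : ℕ}

namespace TopPacking

/-- On `L` the top relay exists: `L ⊆ ⋃_{x ∈ A} W_x`, for any ranking. [folklore] -/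
theorem L_subset_biUnion (A : Finset (Fin n)) (o : Fin n) (j : ℕ) (rk : Fin n → ℕ) :
    {ω : BondConfig (Fin n) | 1 ≤ (A.filter fun z => ω ∈ openConn o z).card ∧
        (A.filter fun z => ω ∈ openConn o z).card ≤ j} ⊆
    ⋃ x ∈ A, ({ω : BondConfig (Fin n) | 1 ≤ (A.filter fun z => ω ∈ openConn o z).card ∧
        (A.filter fun z => ω ∈ openConn o z).card ≤ j} ∩
      {ω | ω ∈ openConn o x} ∩ {ω | ∀ y ∈ A, rk y < rk x → ω ∉ openConn o y}) := by
  intro ω hω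
  have h1 : 1 ≤ (A.filter fun z => ω ∈ openConn o z).card := hω.1
  have hne : (A.filter fun z => ω ∈ openConn o z).Nonempty := by
    rw [← Finset.card_pos]; omega
  obtain ⟨x, hx, hmin⟩ := Finset.exists_min_image _ rk hne
  rw [Finset.mem_filter] at hx
  refine mem_iUnion₂.2 ⟨x, hx.1, ⟨hω, hx.2⟩, ?_⟩
  intro y hy hlt hoy
  have := hmin y (Finset.mem_filter.2 ⟨hy, hoy⟩)
  omega

/-- The events `W_x` (`x ∈ A`) are pairwise disjoint when the ranking is injective on `A`. [folklore] -/
theorem pairwiseDisjoint_W (A : Finset (Fin n)) (o : Fin n) (j : ℕ) (rk : Fin n → ℕ)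
    (hrk : Set.InjOn rk ↑A) :
    (↑A : Set (Fin n)).PairwiseDisjoint fun x =>
      ({ω : BondConfig (Fin n) | 1 ≤ (A.filter fun z => ω ∈ openConn o z).card ∧
          (A.filter fun z => ω ∈ openConn o z).card ≤ j} ∩
        {ω | ω ∈ openConn o x} ∩ {ω | ∀ y ∈ A, rk y < rk x → ω ∉ openConn o y}) := by
  intro x hx y hy hxy
  rw [Function.onFun, Set.disjoint_left]
  rintro ω ⟨⟨_, hox⟩, hx'⟩ ⟨⟨_, hoy⟩, hy'⟩
  have hne : rk x ≠ rk y := fun h => hxy (hrk hx hy h)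
  rcases lt_or_gt_of_ne hne with h | h
  · exact hy' x hx h hox
  · exact hx' y hy h hoy

/-- **Partition by the top relay**: `μ(L) = Σ_{x ∈ A} μ(W_x)`. [folklore] -/
theorem real_L_eq_sum (w : Sym2 (Fin n) → unitInterval) (A : Finset (Fin n)) (o : Fin n) (j : ℕ)
    (rk : Fin n → ℕ) (hrk : Set.InjOn rk ↑A) :
    (prodBernoulli w).real
        {ω : BondConfig (Fin n) | 1 ≤ (A.filter fun z => ω ∈ openConn o z).card ∧
            (A.filter fun z => ω ∈ openConn o z).card ≤ j} =
      ∑ x ∈ A, (prodBernoulli w).real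
        ({ω : BondConfig (Fin n) | 1 ≤ (A.filter fun z => ω ∈ openConn o z).card ∧
            (A.filter fun z => ω ∈ openConn o z).card ≤ j} ∩
          {ω | ω ∈ openConn o x} ∩ {ω | ∀ y ∈ A, rk y < rk x → ω ∉ openConn o y}) := by
  rw [← measureReal_biUnion_finset (pairwiseDisjoint_W A o j rk hrk)
    (fun _ _ => MeasurableSet.of_discrete)]
  congr 1
  apply Set.Subset.antisymm (L_subset_biUnion A o j rk)
  intro ω hω
  obtain ⟨x, -, hx⟩ := mem_iUnion₂.1 hω
  exact hx.1.1

/-- `W_x ⊆ R_x`: on `W_x` the block of `x` is the (small) block of `o`. [folklore] -/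
theorem W_subset_R (A : Finset (Fin n)) (o x : Fin n) (j : ℕ) (rk : Fin n → ℕ) :
    ({ω : BondConfig (Fin n) | 1 ≤ (A.filter fun z => ω ∈ openConn o z).card ∧
          (A.filter fun z => ω ∈ openConn o z).card ≤ j} ∩
        {ω | ω ∈ openConn o x} ∩ {ω | ∀ y ∈ A, rk y < rk x → ω ∉ openConn o y}) ⊆
    {ω : BondConfig (Fin n) | (A.filter fun z => ω ∈ openConn x z).card ≤ j} := by
  rintro ω ⟨⟨⟨_, hle⟩, hox⟩, -⟩
  have hox' : ω ∈ openConn o x := hox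
  rw [mem_setOf_eq, GuardedCIL.filter_eq_of_reachable A hox']
  exact hle

end TopPacking

open TopPacking GuardedTopPacking in
/-- **TP ⇒ CIL.**  If for every finite weighted graph, relay set, observer `o ∉ A`, level and every ranking `rk`
of the relays that is injective on `A` and along which `S(x) = μ(R_x)` is non-increasing, the unguarded top packing
inequality `Σ_{x∈A} μ(W_x)/S(x) ≤ 1` holds, then the cumulative isolation lemma holds (hypothesis shape of
`Theorems.noHeavyLowerTail_of_stub_cumulativeIsolation`): `μ(L) = Σ_x S(x)·(μ(W_x)/S(x)) ≤ max_x S(x)`. -/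
theorem cumulativeIsolation_of_topPacking
    (hTP : ∀ (n : ℕ) (w : Sym2 (Fin n) → unitInterval) (A : Finset (Fin n)) (o : Fin n) (j : ℕ)
      (rk : Fin n → ℕ), o ∉ A → Set.InjOn rk ↑A →
      (∀ x ∈ A, ∀ y ∈ A, rk x < rk y →
        (prodBernoulli w).real {ω : BondConfig (Fin n) | (A.filter fun z => ω ∈ openConn y z).card ≤ j} ≤
          (prodBernoulli w).real {ω : BondConfig (Fin n) | (A.filter fun z => ω ∈ openConn x z).card ≤ j}) →
      ∑ x ∈ A,
        (prodBernoulli w).real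
            ({ω : BondConfig (Fin n) | 1 ≤ (A.filter fun z => ω ∈ openConn o z).card ∧
                (A.filter fun z => ω ∈ openConn o z).card ≤ j} ∩
              {ω | ω ∈ openConn o x} ∩ {ω | ∀ y ∈ A, rk y < rk x → ω ∉ openConn o y}) /
          (prodBernoulli w).real {ω : BondConfig (Fin n) | (A.filter fun z => ω ∈ openConn x z).card ≤ j} ≤ 1) :
    ∀ (n : ℕ) (w : Sym2 (Fin n) → unitInterval) (A : Finset (Fin n)) (o : Fin n) (j : ℕ),
      A.Nonempty → o ∉ A → ∃ a ∈ A,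
        (Literature.Probability.LatticeModels.prodBernoulli w).real
            {ω : Literature.Probability.Percolation.BondConfig (Fin n) |
              1 ≤ (A.filter fun x => ω ∈ Literature.Probability.Percolation.openConn o x).card ∧
                (A.filter fun x => ω ∈ Literature.Probability.Percolation.openConn o x).card ≤ j} ≤
          (Literature.Probability.LatticeModels.prodBernoulli w).real
            {ω : Literature.Probability.Percolation.BondConfig (Fin n) |
              (A.filter fun x => ω ∈ Literature.Probability.Percolation.openConn a x).card ≤ j} := by
  intro n w A o j hA ho
  set μ := prodBernoulli w with hμ
  -- S and the canonical ranking (largest S first, ties by index)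
  set S : Fin n → ℝ := fun x =>
    μ.real {ω : BondConfig (Fin n) | (A.filter fun z => ω ∈ openConn x z).card ≤ j} with hS
  set rk : Fin n → ℕ := fun x => (A.filter fun z => S x < S z ∨ (S z = S x ∧ z < x)).card with hrk
  have hinj : Set.InjOn rk ↑A := rank_injOn A S
  have hanti : ∀ x ∈ A, ∀ y ∈ A, rk x < rk y → S y ≤ S x :=
    fun x hx y hy h => rank_antitone A S hx hy h
  obtain ⟨a, ha, hmax⟩ := Finset.exists_max_image A S hA
  refine ⟨a, ha, ?_⟩
  set W : Fin n → Set (BondConfig (Fin n)) := fun x =>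
    ({ω : BondConfig (Fin n) | 1 ≤ (A.filter fun z => ω ∈ openConn o z).card ∧
        (A.filter fun z => ω ∈ openConn o z).card ≤ j} ∩
      {ω | ω ∈ openConn o x} ∩ {ω | ∀ y ∈ A, rk y < rk x → ω ∉ openConn o y}) with hW
  have hpack : ∑ x ∈ A, μ.real (W x) / S x ≤ 1 := hTP n w A o j rk ho hinj hanti
  have hsum := real_L_eq_sum w A o j rk hinj
  have hterm : ∀ x ∈ A, μ.real (W x) ≤ S a * (μ.real (W x) / S x) := by
    intro x hx
    have hWle : μ.real (W x) ≤ S x := measureReal_mono (W_subset_R A o x j rk) (measure_ne_top _ _)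
    have hS0 : 0 ≤ S x := measureReal_nonneg
    rcases eq_or_lt_of_le hS0 with h0 | hpos
    · have hW0 : μ.real (W x) = 0 := le_antisymm (h0 ▸ hWle) measureReal_nonneg
      rw [hW0]; simp
    · calc μ.real (W x) = S x * (μ.real (W x) / S x) := by field_simp
        _ ≤ S a * (μ.real (W x) / S x) :=
          mul_le_mul_of_nonneg_right (hmax x hx) (div_nonneg measureReal_nonneg hS0)
  calc μ.real {ω : BondConfig (Fin n) | 1 ≤ (A.filter fun z => ω ∈ openConn o z).card ∧
            (A.filter fun z => ω ∈ openConn o z).card ≤ j}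
      = ∑ x ∈ A, μ.real (W x) := hsum
    _ ≤ ∑ x ∈ A, S a * (μ.real (W x) / S x) := Finset.sum_le_sum hterm
    _ = S a * ∑ x ∈ A, μ.real (W x) / S x := by rw [Finset.mul_sum]
    _ ≤ S a * 1 := mul_le_mul_of_nonneg_left hpack measureReal_nonneg
    _ = S a := mul_one _

/-- **The unguarded top packing (all levels, all `S`-antitone rankings) closes the crux `NoHeavyLowerTail`**,
through `cumulativeIsolation_of_topPacking` and `noHeavyLowerTail_of_stub_cumulativeIsolation`. -/
theorem noHeavyLowerTail_of_topPacking
    (hTP : ∀ (n : ℕ) (w : Sym2 (Fin n) → unitInterval) (A : Finset (Fin n)) (o : Fin n) (j : ℕ)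
      (rk : Fin n → ℕ), o ∉ A → Set.InjOn rk ↑A →
      (∀ x ∈ A, ∀ y ∈ A, rk x < rk y →
        (prodBernoulli w).real {ω : BondConfig (Fin n) | (A.filter fun z => ω ∈ openConn y z).card ≤ j} ≤
          (prodBernoulli w).real {ω : BondConfig (Fin n) | (A.filter fun z => ω ∈ openConn x z).card ≤ j}) →
      ∑ x ∈ A,
        (prodBernoulli w).real
            ({ω : BondConfig (Fin n) | 1 ≤ (A.filter fun z => ω ∈ openConn o z).card ∧
                (A.filter fun z => ω ∈ openConn o z).card ≤ j} ∩
              {ω | ω ∈ openConn o x} ∩ {ω | ∀ y ∈ A, rk y < rk x → ω ∉ openConn o y}) /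
          (prodBernoulli w).real {ω : BondConfig (Fin n) | (A.filter fun z => ω ∈ openConn x z).card ≤ j} ≤ 1) :
    Summit.CriticalPhenomena.PercolationContinuityZ3.Theses.PercNearOneGluing.NoHeavyLowerTail :=
  noHeavyLowerTail_of_stub_cumulativeIsolation (cumulativeIsolation_of_topPacking hTP)

end Summit.CriticalPhenomena.PercolationContinuityZ3.Theorems

end
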